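import Summits.BirchSwinnertonDyer.Rank1Residual.X11b.JetchevConnectedKummerCore
import Literature.NumberTheory.EllipticCurves.GaloisAction
import Literature.NumberTheory.EllipticCurves.Tamagawa
import Mathlib.GroupTheory.QuotientGroup.Basic
import HarnessLib

/-!
# X11b at `p = 3` (team N8/O2), JET3-KUMMER (LEAD DEAL #3a): Jetchev's connected-Kummer step at a
# bad place ON POINTS — `JetchevConnectedKummerCore` instantiated with `Φ = E(L)/E₀(L)`

HONEST FRAMING (cell `b2b-bsdres`, run/shared/lean/b2b/bsd-rank1-residual/, verbatim in every
file): the goal of the cell is to DELETE the COMBINATION-SHAPED residual classes of the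
Birch–Swinnerton-Dyer formula for ALL analytic-rank `≤ 1` elliptic curves over `ℚ` — "full BSD
formula for every rank `≤ 1` curve in class `C`" assembled STRICTLY from published theorems — so
that the rank-`≤ 1` remainder becomes exactly the CONSTRUCTION-SHAPED classes, which are TYPED
(missing-input `Prop`s), NOT attempted. This is not "finishing BSD". Team N8/O2 = `x11b3`, seat
`b2b-bsdres-x11b3-p1`, LEAD DEAL #3a row JET3-KUMMER (= harvest E66 (D) scoped to `v ∣ p = 3 ∥ N`;
design per harvest-2 GEN 31 (2): NO new Néron-type hypothesis structure — the component group is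
the honest quotient `E(L)/E₀(L)`). Nothing is booked; the flag `JET@p|N` of
`X11b/JetchevChaRoute.lean` is NOT discharged here (inputs (a)–(c), (α) below stay named inputs).
ONE auxiliary construction (`quotientDistribMulAction`: the action of a group on `A ⧸ B` for a
stable subgroup `B`) + THEOREMS; no named fact; no `sorry`.

## What (HARVEST §GEN-29 E66 (C)(ii) `L-JET-v∣p`, steps (c)–(e); Jetchev 2008 Prop. 4.1 at `v`)

Dictionary: `F = K_v` (`= ℚ_p` at `v ∣ p ∥ N`, `p` split in the Heegner field), `L = K[c]_w ⊇ F`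
(unramified), `D = Gal(L/F) = L ≃ₐ[F] L` acting on `A = E(L) = (W.baseChange L).toAffine.Point`
coordinatewise (tree instance `WeierstrassCurve.instDistribMulActionAlgEquivPoint`),
`E₀(L) = (W.baseChange L).goodReductionSubgroup R` for the valuation ring `R` of `L` (the `v`-minimal
equation stays minimal over the unramified `L`, Silverman AEC VII.5.4 (a)), `Φ := E(L) ⧸ E₀(L)` with
the induced `D`-action (needs `E₀(L)` `D`-stable: hypothesis `hstab`), `π` the quotient map.
`exists_mem_goodReductionSubgroup_add_pow_smul`: if `T ∈ E(L)^D` (printed `T ∈ E(K_v)` with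
`loc_v κ_{c,m} = δ_v(T)` — input (a), Gross 1991 Prop. 6.2 (1) at `v ∣ N`), `p^m U = P_c − T`,
`(σ−1)U = R_σ` (the explicit cocycle, Jetchev (4) / McCallum Lemma 4.1), `n′P_c ∈ E₀(L)` and
`n′R_σ ∈ E₀(L)` with `n′` prime to `p` (input (b): Jetchev Lemma 4.2 = [GZ86, III 3.1] + Gross's
integrality of `R_σ`, `n′ = #E(ℚ)_tors`), and (α) `(E(L)/E₀(L))^D = image of E(L)^D`
(`H¹(Gal(L_w/K_v), E₀(L_w)) = 0`, Gross p. 244 "[M; Ch. I, Prop. 3.8]" = Milne ADT I.3.8 / Lang;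
hypothesis `hα`), then `T = T₀ + p^m T₁` with `T₀ ∈ E₀(L)` and `T₀, T₁ ∈ E(L)^D` — i.e.
`δ_v(T) ∈ δ_v(E₀) = H¹_{Kum⁰}(K_v, E[p^m])`, Prop. 4.1 at `v` WITHOUT Jetchev's Lemma 4.3
(`p`-divisibility of `E⁰(K_v^ur)`, which needs `v ∤ p`). The algebra is p248445's
`JetchevConnectedKummerCore.exists_fixed_decomposition`.

NOT here (named inputs / help-wanted): (a), (b), (α) as above; (c) the typed connected local
condition and its link to `ClassX11b.bsdp_of_jetchevChaCertificate_of_carayol`; (d) `E₀(L)^D =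
E₀(F)`; `hstab` (Galois stability of `E₀(L)`: `σ(R) = R` for the valuation ring). References
(locators only): [cite: Jetchev2008, Prop. 4.1 (p. 819), Lemmas 4.2–4.3 (p. 820)]
[cite: GrossLMS1991, Prop. 6.2 (1), pp. 244–245] [cite: MilneADT2006, Ch. I Prop. 3.8].
-/

noncomputable section

open scoped Classical

namespace Summit.BirchSwinnertonDyer.Rank1Residual.X11b.Three.JetchevKummer

open WeierstrassCurve

universe u

/-! ### The action of a group on `A ⧸ B` for a stable subgroup `B` -/

section Quotient

variable {D A : Type*} [Group D] [AddCommGroup A] [DistribMulAction D A] (B : AddSubgroup A)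

/-- **The induced action on `A ⧸ B`** when `B` is `D`-stable: `σ • (a + B) = σ a + B`
(`QuotientAddGroup.map` of the group endomorphism `a ↦ σ • a`). [folklore] -/
abbrev quotientDistribMulAction (hB : ∀ (σ : D) (a : A), a ∈ B → σ • a ∈ B) :
    DistribMulAction D (A ⧸ B) where
  smul σ := QuotientAddGroup.map B B (DistribSMul.toAddMonoidHom A σ) fun a ha ↦ hB σ a ha
  one_smul q := by
    induction q using QuotientAddGroup.induction_on with
    | H a =>
      change QuotientAddGroup.map B B (DistribSMul.toAddMonoidHom A (1 : D)) _ (a : A ⧸ B) = _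
      rw [QuotientAddGroup.map_mk, DistribSMul.toAddMonoidHom_apply, one_smul]
  mul_smul σ τ q := by
    induction q using QuotientAddGroup.induction_on with
    | H a =>
      change QuotientAddGroup.map B B (DistribSMul.toAddMonoidHom A (σ * τ)) _ (a : A ⧸ B) =
        QuotientAddGroup.map B B (DistribSMul.toAddMonoidHom A σ) _
          (QuotientAddGroup.map B B (DistribSMul.toAddMonoidHom A τ) _ (a : A ⧸ B))
      rw [QuotientAddGroup.map_mk, QuotientAddGroup.map_mk, QuotientAddGroup.map_mk,
        DistribSMul.toAddMonoidHom_apply, DistribSMul.toAddMonoidHom_apply,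
        DistribSMul.toAddMonoidHom_apply, mul_smul]
  smul_zero σ := map_zero _
  smul_add σ x y := map_add _ x y

/-- Unfolding: `σ • (a + B) = σ a + B`. [folklore] -/
theorem quotientDistribMulAction_smul_mk (hB : ∀ (σ : D) (a : A), a ∈ B → σ • a ∈ B)
    (σ : D) (a : A) :
    (letI := quotientDistribMulAction B hB; σ • (a : A ⧸ B)) = ((σ • a : A) : A ⧸ B) := by
  letI := quotientDistribMulAction B hB
  change QuotientAddGroup.map B B (DistribSMul.toAddMonoidHom A σ) _ (a : A ⧸ B) = _
  rw [QuotientAddGroup.map_mk, DistribSMul.toAddMonoidHom_apply]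

/-- **The algebraic core on `A ⧸ B`.** For a `D`-stable subgroup `B ≤ A` with
(α) "`(A/B)^D` is the image of `A^D`" (as: every `a` with all `σ a − a ∈ B` is congruent mod `B` to
a `D`-fixed element), `n′` prime to `p^m`, `T` fixed, `n′P ∈ B`, `n′R σ ∈ B`, `σ U − U = R σ`,
`p^m U = P − T`: `T = T₀ + p^m T₁` with `T₀ ∈ B`, `T₀, T₁` fixed
(`JetchevConnectedKummerCore.exists_fixed_decomposition` with `Φ = A ⧸ B`, `π` the quotient map).
[folklore] -/
theorem exists_mem_add_pow_smul_of_stable (hB : ∀ (σ : D) (a : A), a ∈ B → σ • a ∈ B)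
    (hα : ∀ a : A, (∀ σ : D, σ • a - a ∈ B) → ∃ a' : A, (∀ σ : D, σ • a' = a') ∧ a - a' ∈ B)
    {p m n' : ℕ} (hcop : Nat.Coprime n' (p ^ m)) {U P T : A} {R : D → A}
    (hT : ∀ σ : D, σ • T = T) (hP : (n' : ℤ) • P ∈ B) (hR : ∀ σ : D, (n' : ℤ) • R σ ∈ B)
    (hU : ∀ σ : D, σ • U - U = R σ) (hpU : ((p ^ m : ℕ) : ℤ) • U = P - T) :
    ∃ T₀ T₁ : A, (∀ σ : D, σ • T₀ = T₀) ∧ (∀ σ : D, σ • T₁ = T₁) ∧ T₀ ∈ B ∧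
      T = T₀ + ((p ^ m : ℕ) : ℤ) • T₁ := by
  letI := quotientDistribMulAction B hB
  set π : A →+ A ⧸ B := QuotientAddGroup.mk' B with hπdef
  have hπ : ∀ (σ : D) (a : A), π (σ • a) = σ • π a := fun σ a ↦ by
    rw [hπdef, QuotientAddGroup.mk'_apply, QuotientAddGroup.mk'_apply,
      quotientDistribMulAction_smul_mk B hB]
  have hsurj : ∀ φ : A ⧸ B, (∀ σ : D, σ • φ = φ) → ∃ a : A, (∀ σ : D, σ • a = a) ∧ π a = φ := by
    intro φ hφ
    induction φ using QuotientAddGroup.induction_on with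
    | H a =>
      have hmem : ∀ σ : D, σ • a - a ∈ B := fun σ ↦ by
        rw [← QuotientAddGroup.eq_iff_sub_mem, ← quotientDistribMulAction_smul_mk B hB]
        exact hφ σ
      obtain ⟨a', ha', hd⟩ := hα a hmem
      refine ⟨a', ha', ?_⟩
      rw [hπdef, QuotientAddGroup.mk'_apply]
      exact QuotientAddGroup.eq_iff_sub_mem.mpr (by simpa using B.neg_mem hd)
  have hP' : (n' : ℤ) • π P = 0 := by
    rw [← map_zsmul, hπdef, QuotientAddGroup.mk'_apply, QuotientAddGroup.eq_zero_iff]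
    exact hP
  have hR' : ∀ σ : D, (n' : ℤ) • π (R σ) = 0 := fun σ ↦ by
    rw [← map_zsmul, hπdef, QuotientAddGroup.mk'_apply, QuotientAddGroup.eq_zero_iff]
    exact hR σ
  obtain ⟨T₀, T₁, h0, h1, hπ0, hT'⟩ :=
    JetchevConnectedKummerCore.exists_fixed_decomposition π hπ hsurj hcop hT hP' hR' hU hpU
  refine ⟨T₀, T₁, h0, h1, ?_, hT'⟩
  rw [hπdef, QuotientAddGroup.mk'_apply, QuotientAddGroup.eq_zero_iff] at hπ0
  exact hπ0

end Quotient

/-! ### On points: `A = E(L)`, `B = E₀(L)`, `D = Gal(L/F)` -/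

section Points

variable {F : Type u} [Field F] (W : WeierstrassCurve F) (L : Type u) [Field L] [Algebra F L]
  (R : Type*) [CommRing R] [IsDomain R] [IsDiscreteValuationRing R] [Algebra R L]
  [IsFractionRing R L] [(W.baseChange L).IsMinimal R]

/-- **`L-JET-v∣p` on points (Jetchev Prop. 4.1 at a bad place, steps (c)–(e)).** With the
dictionary of the module docstring: `T = T₀ + p^m T₁`, `T₀ ∈ E₀(L)`, `T₀, T₁ ∈ E(L)^{Gal(L/F)}`.
Inputs carried as hypotheses: `hstab` (Galois stability of `E₀(L)`), `hα` ((α):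
`H¹(Gal(L/F), E₀(L)) = 0` in the form "`(E(L)/E₀(L))^{Gal}` is the image of `E(L)^{Gal}`"), `hT`
(input (a)), `hP`/`hR` (input (b)), `hU`/`hpU` (the explicit cocycle).
[cite: Jetchev2008, Prop. 4.1 (p. 819)] [cite: GrossLMS1991, Prop. 6.2 (1), pp. 244–245] -/
theorem exists_mem_goodReductionSubgroup_add_pow_smul
    (hstab : ∀ (σ : L ≃ₐ[F] L) (Q : (W.baseChange L).toAffine.Point),
      Q ∈ (W.baseChange L).goodReductionSubgroup R → σ • Q ∈ (W.baseChange L).goodReductionSubgroup R)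
    (hα : ∀ Q : (W.baseChange L).toAffine.Point,
      (∀ σ : L ≃ₐ[F] L, σ • Q - Q ∈ (W.baseChange L).goodReductionSubgroup R) →
        ∃ Q' : (W.baseChange L).toAffine.Point, (∀ σ : L ≃ₐ[F] L, σ • Q' = Q') ∧
          Q - Q' ∈ (W.baseChange L).goodReductionSubgroup R)
    {p m n' : ℕ} (hcop : Nat.Coprime n' (p ^ m)) {U P T : (W.baseChange L).toAffine.Point}
    {Rσ : (L ≃ₐ[F] L) → (W.baseChange L).toAffine.Point}
    (hT : ∀ σ : L ≃ₐ[F] L, σ • T = T)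
    (hP : (n' : ℤ) • P ∈ (W.baseChange L).goodReductionSubgroup R)
    (hR : ∀ σ : L ≃ₐ[F] L, (n' : ℤ) • Rσ σ ∈ (W.baseChange L).goodReductionSubgroup R)
    (hU : ∀ σ : L ≃ₐ[F] L, σ • U - U = Rσ σ) (hpU : ((p ^ m : ℕ) : ℤ) • U = P - T) :
    ∃ T₀ T₁ : (W.baseChange L).toAffine.Point,
      (∀ σ : L ≃ₐ[F] L, σ • T₀ = T₀) ∧ (∀ σ : L ≃ₐ[F] L, σ • T₁ = T₁) ∧
      T₀ ∈ (W.baseChange L).goodReductionSubgroup R ∧ T = T₀ + ((p ^ m : ℕ) : ℤ) • T₁ :=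
  exists_mem_add_pow_smul_of_stable ((W.baseChange L).goodReductionSubgroup R) hstab hα hcop hT hP
    hR hU hpU

end Points

end Summit.BirchSwinnertonDyer.Rank1Residual.X11b.Three.JetchevKummer

end
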